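import Mathlib

/-!
# Stub `stub_supBound` of line `Sketch` for crux `TameOrBrodyR4` (stmt-SmoothPoincare4-7826, route SullivanDual)

Sup bound by the `L¹` norm of the mixed second derivative: for a compactly supported `C^∞` map
`W : ℂ → ℝ⁴` and every `z`, `‖W z‖ ≤ ∫ ‖∂₂∂₁W‖`, where `∂₁U = dU(·) 1` and `∂₂U = dU(·) i`
(the case `n = 2`, `p = 1` of the point embedding `W^{n,1} ↪ C⁰`). Proof (fundamental theorem
of calculus twice and Tonelli, carried out in `ℝ≥0∞` so that no integrability is needed before
the last line):

* `SupBound.enorm_le_lintegral_line` — the one-dimensional step along a line `t ↦ a + t • v`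
  (`v ≠ 0`) for a `C¹` compactly supported `F : ℂ → E`:
  `‖F (a + t₀ • v)‖ₑ ≤ ∫⁻ t, ‖dF(a + t • v) v‖ₑ` (Mathlib's
  `HasCompactSupport.enorm_le_lintegral_Ici_deriv`, the chain rule, and the closed embedding
  `t ↦ a + t • v` for the compact support of the restriction);
* the step is applied to `W` along the horizontal line through `z`, then to `∂₁W` along every
  vertical line; `lintegral_mono`, Tonelli on `ℝ × ℝ` (`MeasureTheory.lintegral_prod`) and the
  measure-preserving equivalence `Complex.measurableEquivRealProd`
  (`Complex.volume_preserving_equiv_real_prod`) identify the iterated integral with `∫⁻ ‖∂₂∂₁W‖ₑ`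
  over `ℂ`;
* back to the Bochner integral with `MeasureTheory.ofReal_integral_norm_eq_lintegral_enorm`
  (`∂₂∂₁W` is continuous with compact support, hence integrable).

Folklore (e.g. Adams 1975, *Sobolev Spaces*, Lemma 5.15; the `ℝ≥0∞` bookkeeping follows the
project file `Literature/Analysis/OperatorTheory/SobolevPointBound.lean`).
-/

noncomputable section

open scoped ContDiff Topology ENNReal
open Filter Set MeasureTheory Topology

-- the registered namespace `Summit.SmoothPoincare4.SmoothPoincare4.…` repeats a component
set_option linter.dupNamespace false

namespace Summit.SmoothPoincare4.SmoothPoincare4.Cruxes.TameOrBrodyR4.Sketch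

/-- Local notation for the model space `ℝ⁴ = EuclideanSpace ℝ (Fin 4)`. -/
local notation "E4" => EuclideanSpace ℝ (Fin 4)

namespace SupBound

variable {E : Type*} [NormedAddCommGroup E] [NormedSpace ℝ E]

/-- The real line `t ↦ a + t • v` through `a` in the direction `v ≠ 0` is a closed embedding
`ℝ → ℂ`. -/
theorem isClosedEmbedding_line (a : ℂ) {v : ℂ} (hv : v ≠ 0) :
    IsClosedEmbedding fun t : ℝ => a + t • v :=
  (Homeomorph.addLeft a).isClosedEmbedding.comp (isClosedEmbedding_smul_left hv)

/-- The real line `t ↦ a + t • v` has derivative `v`. -/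
theorem hasDerivAt_line (a v : ℂ) (t : ℝ) : HasDerivAt (fun t : ℝ => a + t • v) v t := by
  simpa only [one_smul] using ((hasDerivAt_id' t).smul_const v).const_add a

/-- **One-dimensional step along a line.** For a `C¹` compactly supported `F : ℂ → E`, a point
`a`, a direction `v ≠ 0` and a parameter `t₀`:
`‖F (a + t₀ • v)‖ₑ ≤ ∫⁻ t, ‖dF(a + t • v) v‖ₑ` (fundamental theorem of calculus on `(-∞, t₀]`). -/
theorem enorm_le_lintegral_line {F : ℂ → E} (hF : ContDiff ℝ 1 F) (hFc : HasCompactSupport F)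
    (a : ℂ) {v : ℂ} (hv : v ≠ 0) (t₀ : ℝ) :
    ‖F (a + t₀ • v)‖ₑ ≤ ∫⁻ t : ℝ, ‖fderiv ℝ F (a + t • v) v‖ₑ := by
  have hf : ContDiff ℝ 1 fun t : ℝ => F (a + t • v) :=
    hF.comp (contDiff_const.add (contDiff_id.smul contDiff_const))
  have hfc : HasCompactSupport fun t : ℝ => F (a + t • v) :=
    hFc.comp_isClosedEmbedding (isClosedEmbedding_line a hv)
  have hderiv : ∀ t, deriv (fun t : ℝ => F (a + t • v)) t = fderiv ℝ F (a + t • v) v := fun t =>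
    ((hF.differentiable one_ne_zero (a + t • v)).hasFDerivAt.comp_hasDerivAt t
      (hasDerivAt_line a v t)).deriv
  calc ‖F (a + t₀ • v)‖ₑ = ‖(fun t : ℝ => F (a + t • v)) t₀‖ₑ := rfl
    _ ≤ ∫⁻ t in Iic t₀, ‖deriv (fun t : ℝ => F (a + t • v)) t‖ₑ :=
        hfc.enorm_le_lintegral_Ici_deriv hf t₀
    _ ≤ ∫⁻ t : ℝ, ‖deriv (fun t : ℝ => F (a + t • v)) t‖ₑ := setLIntegral_le_lintegral _ _
    _ = ∫⁻ t : ℝ, ‖fderiv ℝ F (a + t • v) v‖ₑ := by simp only [hderiv]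

end SupBound

/-- **Sup bound by the `L¹` norm of the mixed second derivative.** For a compactly supported
`C^∞` map `W : ℂ → ℝ⁴` and every `z`: `‖W z‖ ≤ ∫ ‖∂₂∂₁W‖`, where `∂₁W = dW(·) 1` and
`∂₂V = dV(·) i`. Proof: the one-dimensional step `SupBound.enorm_le_lintegral_line` along the
horizontal line through `z` (for `W`) and along every vertical line (for `∂₁W`), then Tonelli on
`ℂ ≃ ℝ × ℝ` (`Complex.volume_preserving_equiv_real_prod`). -/
theorem stub_supBound (W : ℂ → E4) (hW : ContDiff ℝ ∞ W) (hWc : HasCompactSupport W) (z : ℂ) :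
    ‖W z‖ ≤ ∫ y, ‖fderiv ℝ (fun x => fderiv ℝ W x 1) y Complex.I‖ := by
  -- `V = ∂₁W` is smooth with compact support, and `∂₂V = ∂₂∂₁W` is continuous with compact support
  set V : ℂ → E4 := fun x => fderiv ℝ W x 1 with hV_def
  have hV : ContDiff ℝ ∞ V := (contDiff_infty_iff_fderiv.mp hW).2.clm_apply contDiff_const
  have hVc : HasCompactSupport V := hWc.fderiv_apply (𝕜 := ℝ) (v := 1)
  have hV₂ : Continuous fun y => fderiv ℝ V y Complex.I :=
    (contDiff_infty_iff_fderiv.mp hV).2.continuous.clm_apply continuous_const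
  have hV₂c : HasCompactSupport fun y => fderiv ℝ V y Complex.I :=
    hVc.fderiv_apply (𝕜 := ℝ) (v := Complex.I)
  have hint : Integrable fun y => fderiv ℝ V y Complex.I := hV₂.integrable_of_hasCompactSupport hV₂c
  -- (1) the horizontal line through `z`: `‖W z‖ ≤ ∫ ‖∂₁W (z.im i + s)‖ ds`
  have h1 : ‖W z‖ₑ ≤ ∫⁻ s : ℝ, ‖V (↑z.im * Complex.I + s • (1 : ℂ))‖ₑ := by
    have hz : (↑z.im * Complex.I + z.re • (1 : ℂ) : ℂ) = z := Complex.ext (by simp) (by simp)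
    calc ‖W z‖ₑ = ‖W (↑z.im * Complex.I + z.re • (1 : ℂ))‖ₑ := by rw [hz]
      _ ≤ ∫⁻ s : ℝ, ‖fderiv ℝ W (↑z.im * Complex.I + s • (1 : ℂ)) 1‖ₑ :=
          SupBound.enorm_le_lintegral_line (hW.of_le (by exact_mod_cast le_top)) hWc _
            one_ne_zero z.re
      _ = ∫⁻ s : ℝ, ‖V (↑z.im * Complex.I + s • (1 : ℂ))‖ₑ := rfl
  -- (2) the vertical lines: `‖∂₁W (z.im i + s)‖ ≤ ∫ ‖∂₂∂₁W (s + t i)‖ dt`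
  have h2 : ∀ s : ℝ, ‖V (↑z.im * Complex.I + s • (1 : ℂ))‖ₑ ≤
      ∫⁻ t : ℝ, ‖fderiv ℝ V (Complex.measurableEquivRealProd.symm (s, t)) Complex.I‖ₑ := by
    intro s
    have hs : (↑z.im * Complex.I + s • (1 : ℂ) : ℂ) = ↑s + z.im • Complex.I :=
      Complex.ext (by simp) (by simp)
    calc ‖V (↑z.im * Complex.I + s • (1 : ℂ))‖ₑ = ‖V (↑s + z.im • Complex.I)‖ₑ := by rw [hs]
      _ ≤ ∫⁻ t : ℝ, ‖fderiv ℝ V (↑s + t • Complex.I) Complex.I‖ₑ :=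
          SupBound.enorm_le_lintegral_line (hV.of_le (by exact_mod_cast le_top)) hVc _
            Complex.I_ne_zero z.im
      _ = ∫⁻ t : ℝ, ‖fderiv ℝ V (Complex.measurableEquivRealProd.symm (s, t)) Complex.I‖ₑ := by
          simp only [Complex.measurableEquivRealProd_symm_apply, Complex.mk_eq_add_mul_I,
            Complex.real_smul]
  -- (3) Tonelli on `ℝ × ℝ` and the measure-preserving equivalence `ℂ ≃ ℝ × ℝ`
  have h3 : ∫⁻ s : ℝ, ∫⁻ t : ℝ,
      ‖fderiv ℝ V (Complex.measurableEquivRealProd.symm (s, t)) Complex.I‖ₑ =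
        ∫⁻ y, ‖fderiv ℝ V y Complex.I‖ₑ := by
    have hmeas : Measurable fun y : ℂ => ‖fderiv ℝ V y Complex.I‖ₑ := hV₂.measurable.enorm
    have hmp : MeasurePreserving Complex.measurableEquivRealProd.symm :=
      Complex.volume_preserving_equiv_real_prod.symm _
    calc ∫⁻ s : ℝ, ∫⁻ t : ℝ,
        ‖fderiv ℝ V (Complex.measurableEquivRealProd.symm (s, t)) Complex.I‖ₑ
        = ∫⁻ p : ℝ × ℝ, ‖fderiv ℝ V (Complex.measurableEquivRealProd.symm p) Complex.I‖ₑ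
            ∂(volume : Measure ℝ).prod volume :=
          (lintegral_prod
            (fun p : ℝ × ℝ => ‖fderiv ℝ V (Complex.measurableEquivRealProd.symm p) Complex.I‖ₑ)
            (hmeas.comp Complex.measurableEquivRealProd.symm.measurable).aemeasurable).symm
      _ = ∫⁻ p : ℝ × ℝ, ‖fderiv ℝ V (Complex.measurableEquivRealProd.symm p) Complex.I‖ₑ := rfl
      _ = ∫⁻ y, ‖fderiv ℝ V y Complex.I‖ₑ := hmp.lintegral_comp hmeas
  -- (4) assemble in `ℝ≥0∞` and return to the Bochner integral
  have h4 : ‖W z‖ₑ ≤ ∫⁻ y, ‖fderiv ℝ V y Complex.I‖ₑ :=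
    h1.trans ((lintegral_mono h2).trans h3.le)
  have h5 : ENNReal.ofReal (∫ y, ‖fderiv ℝ V y Complex.I‖) = ∫⁻ y, ‖fderiv ℝ V y Complex.I‖ₑ :=
    ofReal_integral_norm_eq_lintegral_enorm hint
  have h6 : ENNReal.ofReal ‖W z‖ ≤ ENNReal.ofReal (∫ y, ‖fderiv ℝ V y Complex.I‖) := by
    rw [ofReal_norm, h5]
    exact h4
  exact (ENNReal.ofReal_le_ofReal_iff (integral_nonneg fun _ => norm_nonneg _)).mp h6

end Summit.SmoothPoincare4.SmoothPoincare4.Cruxes.TameOrBrodyR4.Sketch
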